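import Literature.NumberTheory.GaloisCohomology.Howard2004.ResidualSelmerEigenpartsProofs
import HarnessLib

/-!
# Howard 2004, Lemma 1.5.3 between the eigenparts of the residual level Selmer groups `Sel_{F̄(nℓ)}^±` and
# `Sel_{F̄(n)}^±` on a `DVRSetting`, as `Module.length` identities over `R_k` (proofs file)

Topic `NumberTheory/GaloisCohomology/Howard2004` (sequel to `ResidualSelmerEigenpartsProofs` (RES-EIGEN: the residual
structure `F̄_k(n)`, its `R_k`-stability witnesses, `τ`-eigenparts), `EigenSelmerParityProofs` (Lemma 1.5.3 (a)/(b) for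
abstract `R`-stable `S`, `E`, `Lf`, `Lt`) and `SelmerStructureModifyOnePlaceProofs` (`𝓗(n) = 𝓗^q(n) ∩ loc_q⁻¹𝓕_q`,
`𝓗(nq) = 𝓗^q(n) ∩ loc_q⁻¹𝒯_q`)).  THEOREMS ONLY: no definition, no named fact, no instance, no notation, no `sorry`.

B. Howard, *The Heegner point Kolyvagin system*, Compositio Math. 140 (2004) = arXiv:1202.6340, Def. 1.5.2 and Lemma
1.5.3 (p. 9 L133–146): «`ρ(n)^±` the `R/𝔪`-dimension of `H¹_{F(n)}(K,T̄)^±` … (a) if `loc_ℓ(H̄(n)^±) ≠ 0` then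
`ρ(nℓ)^± = ρ(n)^± − 1`; (b) if `loc_ℓ(H̄(n)^±) = 0` then `ρ(nℓ)^± = ρ(n)^± + 1`».  Here `H̄(n)^± := Sel_{F̄_k(n)} ⊓ E` for
an `R_k`-stable subgroup `E` of `H¹(K, T̄)` (`E = ker(τ_* ∓ id)`, witnesses `scalarMapH1_mem_kerSub/Add`), with
`F̄_k(n) := ((hy.h1 k).1.propagateStructure (S.t k).cond).modify (transverseStructure p S.ρbar S.jbar) ∅ ∅ n`, the
relaxed structure `F̄_k^ℓ(n)` (`modify … {ℓ} ∅ n`), `Lf := F̄_k(ℓ)`, `Lt := 𝒯̄(ℓ)`; the Galois inputs of Lemma 1.5.3 —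
`hdis` (Prop. 1.1.9), `hGD` (the (GD-line) count `length loc_ℓ(Sel_{F̄^ℓ(n)} ⊓ E) = 1`), `hor` (the dichotomy,
`EigenSelmerDichotomyProofs`) — are BINDERS in the shapes of `EigenSelmerParityProofs`, the stability witnesses being
the fixed public terms `scalarMapH1_mem_inf … (S.scalarMapH1_mem_residualSelmer_modify …) hE` (quote them verbatim;
an explicitly re-elaborated `E` makes the unifier diverge — pass `E := _`).

* `length_submoduleOfStable_congr`, `exists_ne_zero_of_length_pos`, `eq_zero_of_length_eq_zero` (generic);
* `scalarMapH1_mem_kerSub`, `scalarMapH1_mem_kerAdd` (the `hE` witnesses for `ker(τ_* ∓ id)`);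
* **`length_eigen_insert_add_one_eq`** (Lemma 1.5.3 (a)): `length (Sel_{F̄(nℓ)} ⊓ E) + 1 = length (Sel_{F̄(n)} ⊓ E)`;
* **`length_eigen_insert_eq_add_one`** (Lemma 1.5.3 (b)): `length (Sel_{F̄(nℓ)} ⊓ E) = length (Sel_{F̄(n)} ⊓ E) + 1`.

Cell `pub/bsd-print-x9`, G87 = Howard Thm. 1.6.1 (print leaf `stub_h161` of stmt-BirchSwinnertonDyer-22642); seat
`bsd-line-x10b-p1-w6` g9, brick (ENGINE-hcheb) part 2b.  BSD is not proved by any of this.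

References: [Howard2004HeegnerKolyvagin] Def. 1.5.2, Lemma 1.5.3; [SerreGaloisCohomology1997] I §2.2.
-/

set_option autoImplicit false

noncomputable section

open Function NumberField IsDedekindDomain Field
open scoped NumberField ContRepresentation Classical

namespace Literature.NumberTheory.GaloisCohomology.Howard2004

open Literature.NumberTheory.GaloisRepresentations
open Literature.NumberTheory.GaloisRepresentations.DiscreteGaloisModule
open Literature.NumberTheory.EllipticCurves

namespace DVRSetting

variable {p : ℕ} [Fact p.Prime] {K : Type} [Field K] [NumberField K]
  {R : Type} [CommRing R] [IsDomain R] [IsDiscreteValuationRing R] [Algebra ℤ_[p] R]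
  {N : ℕ → Type} [∀ k, AddCommGroup (N k)] [∀ k, TopologicalSpace (N k)]
  [∀ k, DiscreteTopology (N k)] [∀ k, Module R (N k)]
  {Rk : ℕ → Type} [∀ k, CommRing (Rk k)] [∀ k, IsLocalRing (Rk k)] [∀ k, TopologicalSpace (Rk k)]
  [∀ k, DiscreteTopology (Rk k)] [∀ k, Algebra ℤ_[p] (Rk k)] [∀ k, Algebra R (Rk k)]
  [∀ k, Module (Rk k) (N k)] [∀ k, IsScalarTower R (Rk k) (N k)]
  {Nbar : Type} [AddCommGroup Nbar] [TopologicalSpace Nbar] [DiscreteTopology Nbar]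
  [∀ k, Module (Rk k) Nbar]
  {Nq : ℕ → Finset (HeightOneSpectrum (𝓞 K)) → Type} [∀ k n, AddCommGroup (Nq k n)]
  [∀ k n, TopologicalSpace (Nq k n)] [∀ k n, DiscreteTopology (Nq k n)]
  [∀ k n, Module (Rk k) (Nq k n)] [∀ k n, Module R (Nq k n)]
  [∀ k n, IsScalarTower R (Rk k) (Nq k n)]

/-! ## Lemma 1.5.3 between `Sel_{F̄(nℓ)} ⊓ E` and `Sel_{F̄(n)} ⊓ E` -/

section Generic

variable {M : Type} [AddCommGroup M] [TopologicalSpace M] [DiscreteTopology M] {A : Type} [CommRing A] [Module A M]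

omit [Fact p.Prime] [NumberField K] in
/-- Equal stable subgroups have the same length (bookkeeping for `ρ(n)^± = length 𝓗̄(n)^±`, Def. 1.5.2).
[cite: Howard2004HeegnerKolyvagin, Def. 1.5.2 (arXiv p. 9 L133–135)] -/
theorem length_submoduleOfStable_congr (ρ : DiscreteGaloisModule K M) (hρ : ρ.IsScalarLinear A)
    {X Y : AddSubgroup (galoisCohomology ρ 1)}
    (hX : ∀ (r : A) {x}, x ∈ X → galoisCohomology.scalarMapH1 ρ hρ r x ∈ X)
    (hY : ∀ (r : A) {x}, x ∈ Y → galoisCohomology.scalarMapH1 ρ hρ r x ∈ Y) (h : X = Y) :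
    letI := galoisCohomology.moduleH1 ρ hρ
    Module.length A ↥(galoisCohomology.submoduleOfStable hρ X hX) =
      Module.length A ↥(galoisCohomology.submoduleOfStable hρ Y hY) := by
  subst h
  rfl

omit [Fact p.Prime] [NumberField K] in
/-- A stable subgroup of positive length has a non-zero element («`ρ(n)⁻ > 0` … some element of
`H¹_{F(n)}(K,T̄)⁻`»). [cite: Howard2004HeegnerKolyvagin, Def. 1.5.2 and Lemma 1.6.4 Case i (arXiv p. 9 L133–135, p. 12 L5–6)] -/
theorem exists_ne_zero_of_length_pos (ρ : DiscreteGaloisModule K M) (hρ : ρ.IsScalarLinear A)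
    {X : AddSubgroup (galoisCohomology ρ 1)}
    (hX : ∀ (r : A) {x}, x ∈ X → galoisCohomology.scalarMapH1 ρ hρ r x ∈ X)
    (h : letI := galoisCohomology.moduleH1 ρ hρ;
      0 < Module.length A ↥(galoisCohomology.submoduleOfStable hρ X hX)) :
    ∃ c ∈ X, c ≠ 0 := by
  letI := galoisCohomology.moduleH1 ρ hρ
  haveI : Nontrivial ↥(galoisCohomology.submoduleOfStable hρ X hX) := Module.length_pos_iff.1 h
  obtain ⟨⟨c, hc⟩, hc0⟩ := exists_ne (0 : ↥(galoisCohomology.submoduleOfStable hρ X hX))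
  exact ⟨c, hc, fun h0 => hc0 (Subtype.ext h0)⟩

omit [Fact p.Prime] [NumberField K] in
/-- A stable subgroup of length zero is zero («`ρ(n)⁻ = 0`», Case ii). [cite: Howard2004HeegnerKolyvagin, Def. 1.5.2 and Lemma 1.6.4 Case ii (arXiv p. 9 L133–135, p. 12 L15–18)] -/
theorem eq_zero_of_length_eq_zero (ρ : DiscreteGaloisModule K M) (hρ : ρ.IsScalarLinear A)
    {X : AddSubgroup (galoisCohomology ρ 1)}
    (hX : ∀ (r : A) {x}, x ∈ X → galoisCohomology.scalarMapH1 ρ hρ r x ∈ X)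
    (h : letI := galoisCohomology.moduleH1 ρ hρ;
      Module.length A ↥(galoisCohomology.submoduleOfStable hρ X hX) = 0) {c : galoisCohomology ρ 1}
    (hc : c ∈ X) : c = 0 := by
  letI := galoisCohomology.moduleH1 ρ hρ
  haveI : Subsingleton ↥(galoisCohomology.submoduleOfStable hρ X hX) := Module.length_eq_zero_iff.1 h
  have h0 : (⟨c, hc⟩ : ↥(galoisCohomology.submoduleOfStable hρ X hX)) = 0 := Subsingleton.elim _ _
  exact congrArg Subtype.val h0

end Generic

/-- The `(+)`-eigen-subgroup `ker(τ_* − id)` of `H¹(K, T̄)` is `R_k`-stable, in the binder shape `hE` of the parity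
lemmas (the stability witness quoted BY NAME in the engine's `ρ⁺` / (GD-line) statements).
[cite: Howard2004HeegnerKolyvagin, Def. 1.5.2 (arXiv p. 9 L133–135)] -/
theorem scalarMapH1_mem_kerSub (S : DVRSetting p K R N Rk Nbar Nq) (hy : S.SatisfiesH) (k : ℕ) :
    ∀ (r : Rk k) {x : galoisCohomology S.ρbar 1},
      x ∈ ((semilinearH S.cd.isLift (S.A k).θ.toAddMonoidHom (S.A k).isSemilinear 1) - AddMonoidHom.id _).ker →
      galoisCohomology.scalarMapH1 S.ρbar (S.isScalarLinear_rhobar hy k) r x ∈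
        ((semilinearH S.cd.isLift (S.A k).θ.toAddMonoidHom (S.A k).isSemilinear 1) - AddMonoidHom.id _).ker :=
  fun r _ hc => ResidualTau.scalarMapH1_mem_ker_sub (S.A k) (S.isScalarLinear_rhobar hy k) r hc

/-- The `(−)`-eigen-subgroup `ker(τ_* + id)` of `H¹(K, T̄)` is `R_k`-stable (binder shape `hE`).
[cite: Howard2004HeegnerKolyvagin, Def. 1.5.2 (arXiv p. 9 L133–135)] -/
theorem scalarMapH1_mem_kerAdd (S : DVRSetting p K R N Rk Nbar Nq) (hy : S.SatisfiesH) (k : ℕ) :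
    ∀ (r : Rk k) {x : galoisCohomology S.ρbar 1},
      x ∈ ((semilinearH S.cd.isLift (S.A k).θ.toAddMonoidHom (S.A k).isSemilinear 1) + AddMonoidHom.id _).ker →
      galoisCohomology.scalarMapH1 S.ρbar (S.isScalarLinear_rhobar hy k) r x ∈
        ((semilinearH S.cd.isLift (S.A k).θ.toAddMonoidHom (S.A k).isSemilinear 1) + AddMonoidHom.id _).ker :=
  fun r _ hc => ResidualTau.scalarMapH1_mem_ker_add (S.A k) (S.isScalarLinear_rhobar hy k) r hc

/-- **Lemma 1.5.3 (a) between the eigenparts of `Sel_{F̄(nℓ)}` and `Sel_{F̄(n)}`** (`ℓ ∉ n`, `E` an `R_k`-stable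
subgroup with witness `hE`, e.g. `ker(τ_* ∓ id)` with `scalarMapH1_mem_kerSub/Add`): given `F̄_ℓ ∩ 𝒯̄_ℓ = 0`, the
(GD-line) count and the dichotomy for the relaxed group `Sel_{F̄^ℓ(n)} ⊓ E`, and a class of `Sel_{F̄(n)} ⊓ E` with
non-zero localisation at `ℓ`: `length (Sel_{F̄(nℓ)} ⊓ E) + 1 = length (Sel_{F̄(n)} ⊓ E)` — «`ρ(nℓ)^± = ρ(n)^± − 1`».
All stability witnesses are the fixed terms `scalarMapH1_mem_inf … (S.scalarMapH1_mem_residualSelmer_modify …) hE`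
(quote them verbatim to instantiate). [cite: Howard2004HeegnerKolyvagin, Lemma 1.5.3 (a) (arXiv p. 9 L141–143, p. 10 L1–19)] -/
theorem length_eigen_insert_add_one_eq (S : DVRSetting p K R N Rk Nbar Nq) (hy : S.SatisfiesH) (k : ℕ)
    {n : Finset (HeightOneSpectrum (𝓞 K))} {v : HeightOneSpectrum (𝓞 K)} (hvn : v ∉ n)
    (E : AddSubgroup (galoisCohomology S.ρbar 1))
    (hE : ∀ (r : Rk k) {x}, x ∈ E → galoisCohomology.scalarMapH1 S.ρbar (S.isScalarLinear_rhobar hy k) r x ∈ E)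
    (hdis : Disjoint (((hy.h1 k).1.propagateStructure (S.t k).cond) (Sum.inr v)) ((transverseStructure p S.ρbar S.jbar) (Sum.inr v)))
    (hGD : letI := (galoisCohomology.moduleH1 (S.ρbar.toLocal (Sum.inr v))
        ((S.isScalarLinear_rhobar hy k).restrictField (Place.Completion (Sum.inr v))));
      Module.length (Rk k) ↥(galoisCohomology.submoduleOfStable
        ((S.isScalarLinear_rhobar hy k).restrictField (Place.Completion (Sum.inr v)))
        (((((hy.h1 k).1.propagateStructure (S.t k).cond).modify (transverseStructure p S.ρbar S.jbar) {v} ∅ n).selmerGroup ⊓ E).map (galoisCohomology.localization S.ρbar (Sum.inr v) 1))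
        (scalarMapH1_mem_map_localization S.ρbar (S.isScalarLinear_rhobar hy k) (Sum.inr v)
          (scalarMapH1_mem_inf S.ρbar (S.isScalarLinear_rhobar hy k) (S.scalarMapH1_mem_residualSelmer_modify hy k {v} ∅ n) hE))) = 1)
    (hor : ((((hy.h1 k).1.propagateStructure (S.t k).cond).modify (transverseStructure p S.ρbar S.jbar) {v} ∅ n).selmerGroup ⊓ E).map (galoisCohomology.localization S.ρbar (Sum.inr v) 1) ≤
          ((hy.h1 k).1.propagateStructure (S.t k).cond) (Sum.inr v) ∨
      ((((hy.h1 k).1.propagateStructure (S.t k).cond).modify (transverseStructure p S.ρbar S.jbar) {v} ∅ n).selmerGroup ⊓ E).map (galoisCohomology.localization S.ρbar (Sum.inr v) 1) ≤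
          (transverseStructure p S.ρbar S.jbar) (Sum.inr v))
    (hne : ∃ c ∈ (((hy.h1 k).1.propagateStructure (S.t k).cond).modify (transverseStructure p S.ρbar S.jbar) ∅ ∅ n).selmerGroup ⊓ E, (galoisCohomology.localization S.ρbar (Sum.inr v) 1) c ≠ 0) :
    letI := galoisCohomology.moduleH1 S.ρbar (S.isScalarLinear_rhobar hy k)
    Module.length (Rk k) ↥(galoisCohomology.submoduleOfStable (S.isScalarLinear_rhobar hy k)
        ((((hy.h1 k).1.propagateStructure (S.t k).cond).modify (transverseStructure p S.ρbar S.jbar) ∅ ∅ (insert v n)).selmerGroup ⊓ E)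
        (scalarMapH1_mem_inf S.ρbar (S.isScalarLinear_rhobar hy k) (S.scalarMapH1_mem_residualSelmer_modify hy k ∅ ∅ (insert v n)) hE)) + 1 =
      Module.length (Rk k) ↥(galoisCohomology.submoduleOfStable (S.isScalarLinear_rhobar hy k)
        ((((hy.h1 k).1.propagateStructure (S.t k).cond).modify (transverseStructure p S.ρbar S.jbar) ∅ ∅ n).selmerGroup ⊓ E)
        (scalarMapH1_mem_inf S.ρbar (S.isScalarLinear_rhobar hy k) (S.scalarMapH1_mem_residualSelmer_modify hy k ∅ ∅ n) hE)) := by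
  have hid_n := SelmerStructure.selmerGroup_modify_level_eq ((hy.h1 k).1.propagateStructure (S.t k).cond) (transverseStructure p S.ρbar S.jbar) v n hvn
  have hid_nv := SelmerStructure.selmerGroup_modify_insert_level_eq ((hy.h1 k).1.propagateStructure (S.t k).cond) (transverseStructure p S.ρbar S.jbar) v n
  obtain ⟨c, hc, hc0⟩ := hne
  have hc1 := hc.1
  rw [hid_n] at hc1
  have hne' : ∃ c ∈ (((hy.h1 k).1.propagateStructure (S.t k).cond).modify (transverseStructure p S.ρbar S.jbar) {v} ∅ n).selmerGroup ⊓ E,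
      (galoisCohomology.localization S.ρbar (Sum.inr v) 1) c ∈ ((hy.h1 k).1.propagateStructure (S.t k).cond) (Sum.inr v) ∧
      (galoisCohomology.localization S.ρbar (Sum.inr v) 1) c ≠ 0 :=
    ⟨c, ⟨hc1.1, hc.2⟩, hc1.2, hc0⟩
  obtain ⟨hlen, -⟩ := length_inf_comap_add_one_eq_of_exists S.ρbar (S.isScalarLinear_rhobar hy k) (Sum.inr v)
    (((hy.h1 k).1.propagateStructure (S.t k).cond).modify (transverseStructure p S.ρbar S.jbar) {v} ∅ n).selmerGroup E (S.scalarMapH1_mem_residualSelmer_modify hy k {v} ∅ n) hE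
    (((hy.h1 k).1.propagateStructure (S.t k).cond) (Sum.inr v)) ((transverseStructure p S.ρbar S.jbar) (Sum.inr v))
    (fun r _ hx => (S.isScalarStable_residualStructure hy k) (Sum.inr v) r hx)
    (fun r _ hx => isScalarStable_transverseStructure p (S.isScalarLinear_rhobar hy k) S.jbar (Sum.inr v) r hx)
    hdis hGD hor hne'
  rw [length_submoduleOfStable_congr S.ρbar (S.isScalarLinear_rhobar hy k)
      (X := (((hy.h1 k).1.propagateStructure (S.t k).cond).modify (transverseStructure p S.ρbar S.jbar) {v} ∅ n).selmerGroup ⊓ E ⊓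
        ((transverseStructure p S.ρbar S.jbar) (Sum.inr v)).comap (galoisCohomology.localization S.ρbar (Sum.inr v) 1)) _
      (scalarMapH1_mem_inf S.ρbar (S.isScalarLinear_rhobar hy k) (S.scalarMapH1_mem_residualSelmer_modify hy k ∅ ∅ (insert v n)) hE)
      (by rw [hid_nv, inf_right_comm])] at hlen
  rw [length_submoduleOfStable_congr S.ρbar (S.isScalarLinear_rhobar hy k)
      (X := (((hy.h1 k).1.propagateStructure (S.t k).cond).modify (transverseStructure p S.ρbar S.jbar) {v} ∅ n).selmerGroup ⊓ E ⊓
        (((hy.h1 k).1.propagateStructure (S.t k).cond) (Sum.inr v)).comap (galoisCohomology.localization S.ρbar (Sum.inr v) 1)) _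
      (scalarMapH1_mem_inf S.ρbar (S.isScalarLinear_rhobar hy k) (S.scalarMapH1_mem_residualSelmer_modify hy k ∅ ∅ n) hE)
      (by rw [hid_n, inf_right_comm])] at hlen
  exact hlen

/-- **Lemma 1.5.3 (b) between the eigenparts of `Sel_{F̄(nℓ)}` and `Sel_{F̄(n)}`**: same letters; if every class of
`Sel_{F̄(n)} ⊓ E` is locally zero at `ℓ` then `length (Sel_{F̄(nℓ)} ⊓ E) = length (Sel_{F̄(n)} ⊓ E) + 1` —
«`ρ(nℓ)^± = ρ(n)^± + 1`». [cite: Howard2004HeegnerKolyvagin, Lemma 1.5.3 (b) (arXiv p. 9 L145–146, p. 10 L21–45)] -/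
theorem length_eigen_insert_eq_add_one (S : DVRSetting p K R N Rk Nbar Nq) (hy : S.SatisfiesH) (k : ℕ)
    {n : Finset (HeightOneSpectrum (𝓞 K))} {v : HeightOneSpectrum (𝓞 K)} (hvn : v ∉ n)
    (E : AddSubgroup (galoisCohomology S.ρbar 1))
    (hE : ∀ (r : Rk k) {x}, x ∈ E → galoisCohomology.scalarMapH1 S.ρbar (S.isScalarLinear_rhobar hy k) r x ∈ E)
    (hdis : Disjoint (((hy.h1 k).1.propagateStructure (S.t k).cond) (Sum.inr v)) ((transverseStructure p S.ρbar S.jbar) (Sum.inr v)))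
    (hGD : letI := (galoisCohomology.moduleH1 (S.ρbar.toLocal (Sum.inr v))
        ((S.isScalarLinear_rhobar hy k).restrictField (Place.Completion (Sum.inr v))));
      Module.length (Rk k) ↥(galoisCohomology.submoduleOfStable
        ((S.isScalarLinear_rhobar hy k).restrictField (Place.Completion (Sum.inr v)))
        (((((hy.h1 k).1.propagateStructure (S.t k).cond).modify (transverseStructure p S.ρbar S.jbar) {v} ∅ n).selmerGroup ⊓ E).map (galoisCohomology.localization S.ρbar (Sum.inr v) 1))
        (scalarMapH1_mem_map_localization S.ρbar (S.isScalarLinear_rhobar hy k) (Sum.inr v)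
          (scalarMapH1_mem_inf S.ρbar (S.isScalarLinear_rhobar hy k) (S.scalarMapH1_mem_residualSelmer_modify hy k {v} ∅ n) hE))) = 1)
    (hor : ((((hy.h1 k).1.propagateStructure (S.t k).cond).modify (transverseStructure p S.ρbar S.jbar) {v} ∅ n).selmerGroup ⊓ E).map (galoisCohomology.localization S.ρbar (Sum.inr v) 1) ≤
          ((hy.h1 k).1.propagateStructure (S.t k).cond) (Sum.inr v) ∨
      ((((hy.h1 k).1.propagateStructure (S.t k).cond).modify (transverseStructure p S.ρbar S.jbar) {v} ∅ n).selmerGroup ⊓ E).map (galoisCohomology.localization S.ρbar (Sum.inr v) 1) ≤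
          (transverseStructure p S.ρbar S.jbar) (Sum.inr v))
    (hzero : ∀ c ∈ (((hy.h1 k).1.propagateStructure (S.t k).cond).modify (transverseStructure p S.ρbar S.jbar) ∅ ∅ n).selmerGroup ⊓ E, (galoisCohomology.localization S.ρbar (Sum.inr v) 1) c = 0) :
    letI := galoisCohomology.moduleH1 S.ρbar (S.isScalarLinear_rhobar hy k)
    Module.length (Rk k) ↥(galoisCohomology.submoduleOfStable (S.isScalarLinear_rhobar hy k)
        ((((hy.h1 k).1.propagateStructure (S.t k).cond).modify (transverseStructure p S.ρbar S.jbar) ∅ ∅ (insert v n)).selmerGroup ⊓ E)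
        (scalarMapH1_mem_inf S.ρbar (S.isScalarLinear_rhobar hy k) (S.scalarMapH1_mem_residualSelmer_modify hy k ∅ ∅ (insert v n)) hE)) =
      Module.length (Rk k) ↥(galoisCohomology.submoduleOfStable (S.isScalarLinear_rhobar hy k)
        ((((hy.h1 k).1.propagateStructure (S.t k).cond).modify (transverseStructure p S.ρbar S.jbar) ∅ ∅ n).selmerGroup ⊓ E)
        (scalarMapH1_mem_inf S.ρbar (S.isScalarLinear_rhobar hy k) (S.scalarMapH1_mem_residualSelmer_modify hy k ∅ ∅ n) hE)) + 1 := by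
  have hid_n := SelmerStructure.selmerGroup_modify_level_eq ((hy.h1 k).1.propagateStructure (S.t k).cond) (transverseStructure p S.ρbar S.jbar) v n hvn
  have hid_nv := SelmerStructure.selmerGroup_modify_insert_level_eq ((hy.h1 k).1.propagateStructure (S.t k).cond) (transverseStructure p S.ρbar S.jbar) v n
  have hzero' : ∀ c ∈ (((hy.h1 k).1.propagateStructure (S.t k).cond).modify (transverseStructure p S.ρbar S.jbar) {v} ∅ n).selmerGroup ⊓ E,
      (galoisCohomology.localization S.ρbar (Sum.inr v) 1) c ∈ ((hy.h1 k).1.propagateStructure (S.t k).cond) (Sum.inr v) →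
      (galoisCohomology.localization S.ρbar (Sum.inr v) 1) c = 0 := by
    intro c hc hcf
    refine hzero c ⟨?_, hc.2⟩
    rw [hid_n]
    exact ⟨hc.1, hcf⟩
  have hlen := length_inf_comap_eq_add_one_of_forall S.ρbar (S.isScalarLinear_rhobar hy k) (Sum.inr v)
    (((hy.h1 k).1.propagateStructure (S.t k).cond).modify (transverseStructure p S.ρbar S.jbar) {v} ∅ n).selmerGroup E (S.scalarMapH1_mem_residualSelmer_modify hy k {v} ∅ n) hE
    (((hy.h1 k).1.propagateStructure (S.t k).cond) (Sum.inr v)) ((transverseStructure p S.ρbar S.jbar) (Sum.inr v))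
    (fun r _ hx => (S.isScalarStable_residualStructure hy k) (Sum.inr v) r hx)
    (fun r _ hx => isScalarStable_transverseStructure p (S.isScalarLinear_rhobar hy k) S.jbar (Sum.inr v) r hx)
    hdis hGD hor hzero'
  rw [length_submoduleOfStable_congr S.ρbar (S.isScalarLinear_rhobar hy k)
      (X := (((hy.h1 k).1.propagateStructure (S.t k).cond).modify (transverseStructure p S.ρbar S.jbar) {v} ∅ n).selmerGroup ⊓ E ⊓
        ((transverseStructure p S.ρbar S.jbar) (Sum.inr v)).comap (galoisCohomology.localization S.ρbar (Sum.inr v) 1)) _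
      (scalarMapH1_mem_inf S.ρbar (S.isScalarLinear_rhobar hy k) (S.scalarMapH1_mem_residualSelmer_modify hy k ∅ ∅ (insert v n)) hE)
      (by rw [hid_nv, inf_right_comm])] at hlen
  rw [length_submoduleOfStable_congr S.ρbar (S.isScalarLinear_rhobar hy k)
      (X := (((hy.h1 k).1.propagateStructure (S.t k).cond).modify (transverseStructure p S.ρbar S.jbar) {v} ∅ n).selmerGroup ⊓ E ⊓
        (((hy.h1 k).1.propagateStructure (S.t k).cond) (Sum.inr v)).comap (galoisCohomology.localization S.ρbar (Sum.inr v) 1)) _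
      (scalarMapH1_mem_inf S.ρbar (S.isScalarLinear_rhobar hy k) (S.scalarMapH1_mem_residualSelmer_modify hy k ∅ ∅ n) hE)
      (by rw [hid_n, inf_right_comm])] at hlen
  exact hlen


end DVRSetting

end Literature.NumberTheory.GaloisCohomology.Howard2004

end
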